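import Literature.NumberTheory.Transcendental.MasserApproxSchwarz
import HarnessLib

/-!
# Masser 1975, Theorem I — the extrapolation step at the points `s + ¼` (Lemmas 1.10, 1.11)

Support for the proof of Theorem I of D. W. Masser, *Elliptic Functions and Transcendence*,
LNM 437 (1975), Ch. I §1.3, on the book's own line towards Theorem II
(`Literature.NumberTheory.Transcendental.masser_ellipticPeriods`).

Both Lemma 1.10 and Lemma 1.11 apply the maximum modulus principle to `φ/F`,
`F(z) = ∏_{s=1}^{h} (z - s - ¼)^k`, on the circle `|z| = 5h`, the function `φ` having SMALL (not
vanishing) derivatives of order `< k` at the points `s + ¼` (eq. (14)). This file packages that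
step, for an arbitrary entire `f`, with all the elementary size bookkeeping done once:
`norm_le_of_small_derivs_quarter` — if `‖f^{(j)}(s + ¼)‖ ≤ η j!` for `1 ≤ s ≤ h`, `j < S`, and
`‖f‖ ≤ Θ` on `|z| = 5(h+1)`, then for `|w| ≤ h + 1`,
`‖f(w)‖ ≤ η Ξ(h, S) + (Θ + η Ξ(h, S)) (5/6)^{S h}` with the explicit factor
`Ξ(h, S) = h S (6h+7)^S (3(6h+7)^h)^{2S}` (`xiFactor`; `log Ξ = O(S h log h)`), from the
quasi-interpolant estimate `MasserApproxSchwarz.norm_le_of_small_derivs` (the book: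
`|F(ζ)/F(z)| ≤ 2^{-hk}`, `|I(m,s)| < c₁₄^k`).

Everything here is proved; no named facts.

## References

* D. W. Masser, *Elliptic Functions and Transcendence*, Lecture Notes in Math. 437, Springer 1975,
  Ch. I §1.3, proofs of Lemmas 1.10 and 1.11 (pp. 7–10), eqs. (13)–(14). [Masser1975]
-/

noncomputable section

open Polynomial Finset Complex Metric

namespace Literature.NumberTheory.Transcendental.Masser1975

/-- The size factor `Ξ(h, S) = h · S · (6h+7)^S · (3 (6h+7)^h)^{2S}` of the extrapolation step.
[cite: Masser1975, §1.3 (proof of Lemma 1.10)] -/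
def xiFactor (h S : ℕ) : ℝ :=
  (h : ℝ) * S * (6 * (h : ℝ) + 7) ^ S * (3 * (6 * (h : ℝ) + 7) ^ h) ^ (2 * S)

/-- `Ξ ≥ 0`. [folklore] -/
theorem xiFactor_nonneg (h S : ℕ) : 0 ≤ xiFactor h S := by
  unfold xiFactor; positivity

/-- The nodes `s + ¼`, `s = 1, …, h`, as a family indexed by `Fin h`. [cite: Masser1975, Lemma 1.10] -/
def quarterNodes (h : ℕ) : Fin h → ℂ := fun s => (((s : ℕ) + 1 : ℕ) : ℂ) + 1 / 4

/-- The nodes are distinct. [folklore] -/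
theorem quarterNodes_injective (h : ℕ) : Function.Injective (quarterNodes h) := by
  intro s t hst
  simp only [quarterNodes, add_left_inj, Nat.cast_inj] at hst
  exact Fin.ext (by omega)

/-- Distinct nodes are at distance `≥ 1`. [folklore] -/
theorem one_le_norm_quarterNodes_sub {h : ℕ} {s t : Fin h} (hst : s ≠ t) :
    1 ≤ ‖quarterNodes h s - quarterNodes h t‖ := by
  have hne : ((s : ℕ) : ℤ) ≠ (t : ℕ) := by
    intro h'; exact hst (Fin.ext (by exact_mod_cast h'))
  have : quarterNodes h s - quarterNodes h t = ((((s : ℕ) : ℤ) - ((t : ℕ) : ℤ) : ℤ) : ℂ) := by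
    simp only [quarterNodes]; push_cast; ring
  rw [this, Complex.norm_intCast]
  exact_mod_cast Int.one_le_abs (sub_ne_zero.mpr hne)

/-- Size of the nodes: `‖s + ¼‖ ≤ h + 2`. [folklore] -/
theorem norm_quarterNodes_le {h : ℕ} (s : Fin h) : ‖quarterNodes h s‖ ≤ (h : ℝ) + 2 := by
  have hs : ((s : ℕ) : ℝ) + 1 ≤ h := by exact_mod_cast s.isLt
  unfold quarterNodes
  calc ‖((((s : ℕ) + 1 : ℕ) : ℂ) + 1 / 4)‖ ≤ ‖(((s : ℕ) + 1 : ℕ) : ℂ)‖ + ‖(1 / 4 : ℂ)‖ := norm_add_le _ _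
    _ = ((s : ℕ) : ℝ) + 1 + 1 / 4 := by
        rw [Complex.norm_natCast, show ‖(1 / 4 : ℂ)‖ = 1 / 4 by norm_num]; push_cast; ring
    _ ≤ (h : ℝ) + 2 := by linarith

/-- **The extrapolation step with approximate zeros.** Let `f` be entire, `h, S ≥ 1`. If
`‖f^{(j)}(s + ¼)‖ ≤ η · j!` for `1 ≤ s ≤ h`, `j < S`, and `‖f(z)‖ ≤ Θ` for `|z| = 5(h+1)`, then
for every `|w| ≤ h + 1`, `‖f(w)‖ ≤ η Ξ + (Θ + η Ξ) (5/6)^{S h}`, `Ξ = xiFactor h S`.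
(Masser, proof of Lemma 1.10: `|φ(ζ)| ≤ |F(ζ)|·[(2πi)⁻¹∮|φ|/(|z-ζ||F|) + ∑ |φ_m(s+¼)|/m! |I(m,s)|]`
with `|F(ζ)/F(z)| ≤ 2^{-hk}`.) [cite: Masser1975, §1.3 (proof of Lemma 1.10, eqs. (13)–(14))] -/
theorem norm_le_of_small_derivs_quarter {f : ℂ → ℂ} (hf : Differentiable ℂ f) {h S : ℕ}
    (hh : 1 ≤ h) (hS : 1 ≤ S) {η Θ : ℝ} (hη0 : 0 ≤ η) (hΘ0 : 0 ≤ Θ)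
    (hη : ∀ s : Fin h, ∀ j < S, ‖iteratedDeriv j f (quarterNodes h s)‖ ≤ η * j.factorial)
    (hΘ : ∀ z ∈ sphere (0 : ℂ) (5 * ((h : ℝ) + 1)), ‖f z‖ ≤ Θ) {w : ℂ} (hw : ‖w‖ ≤ (h : ℝ) + 1) :
    ‖f w‖ ≤ η * xiFactor h S + (Θ + η * xiFactor h S) * (5 / 6 : ℝ) ^ (S * h) := by
  set c := quarterNodes h with hc
  set R : ℝ := 5 * ((h : ℝ) + 1) with hR
  have hh1 : (1 : ℝ) ≤ h := by exact_mod_cast hh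
  have hR0 : 0 < R := by positivity
  set X : ℝ := 6 * (h : ℝ) + 7 with hX
  have hX1 : 1 ≤ X := by rw [hX]; linarith
  -- sizes of `z - c_s` for `‖z‖ ≤ R`
  have hzc : ∀ z : ℂ, ‖z‖ ≤ R → ∀ s, ‖z - c s‖ ≤ X := by
    intro z hz s
    calc ‖z - c s‖ ≤ ‖z‖ + ‖c s‖ := norm_sub_le _ _
      _ ≤ R + ((h : ℝ) + 2) := add_le_add hz (norm_quarterNodes_le s)
      _ = X := by rw [hR, hX]; ring
  -- the Lagrange basis polynomials are `≤ X^h` in size for `‖z‖ ≤ R`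
  have hℓ : ∀ z : ℂ, ‖z‖ ≤ R → ∀ s, ‖(Lagrange.basis univ c s).eval z‖ ≤ X ^ h := by
    intro z hz s
    rw [norm_lagrange_basis_eval]
    calc ∏ t ∈ univ.erase s, ‖z - c t‖ / ‖c s - c t‖ ≤ ∏ _t ∈ univ.erase s, X := by
          refine Finset.prod_le_prod (fun t _ => by positivity) fun t ht => ?_
          have hsep := one_le_norm_quarterNodes_sub (h := h) (ne_of_mem_erase ht).symm
          rw [div_le_iff₀ (lt_of_lt_of_le one_pos hsep)]
          calc ‖z - c t‖ ≤ X := hzc z hz t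
            _ = X * 1 := (mul_one _).symm
            _ ≤ X * ‖c s - c t‖ := mul_le_mul_of_nonneg_left hsep (by positivity)
      _ = X ^ (univ.erase s).card := Finset.prod_const _
      _ ≤ X ^ h := by
          apply pow_le_pow_right₀ hX1
          rw [Finset.card_erase_of_mem (mem_univ s), Finset.card_univ, Fintype.card_fin]
          omega
  -- the quasi-interpolant is `≤ η Ξ` on `‖z‖ ≤ R`
  have hq : ∀ z : ℂ, ‖z‖ ≤ R → ‖(quasiInterp c S f).eval z‖ ≤ η * xiFactor h S := by
    intro z hz
    refine (norm_quasiInterp_le c S f z).trans ?_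
    have hinner : ∀ s, (∑ m ∈ Finset.range S, ‖iteratedDeriv m f (c s)‖ / m.factorial *
        ‖z - c s‖ ^ m) ≤ S * (η * X ^ S) := by
      intro s
      calc (∑ m ∈ Finset.range S, ‖iteratedDeriv m f (c s)‖ / m.factorial * ‖z - c s‖ ^ m)
          ≤ ∑ _m ∈ Finset.range S, η * X ^ S := by
            refine Finset.sum_le_sum fun m hm => ?_
            have hm' : m < S := Finset.mem_range.mp hm
            have hfac : (0 : ℝ) < m.factorial := by exact_mod_cast m.factorial_pos
            have h1 : ‖iteratedDeriv m f (c s)‖ / m.factorial ≤ η := by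
              rw [div_le_iff₀ hfac]; exact hη s m hm'
            have h2 : ‖z - c s‖ ^ m ≤ X ^ S :=
              (pow_le_pow_left₀ (norm_nonneg _) (hzc z hz s) m).trans
                (pow_le_pow_right₀ hX1 hm'.le)
            exact mul_le_mul h1 h2 (by positivity) hη0
        _ = S * (η * X ^ S) := by rw [Finset.sum_const, Finset.card_range, nsmul_eq_mul]
    have houter : ∀ s, (1 + 2 * ‖(Lagrange.basis univ c s).eval z‖) ^ (2 * S - 1) ≤
        (3 * X ^ h) ^ (2 * S) := by
      intro s
      have hXh : 1 ≤ X ^ h := one_le_pow₀ hX1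
      calc (1 + 2 * ‖(Lagrange.basis univ c s).eval z‖) ^ (2 * S - 1)
          ≤ (3 * X ^ h) ^ (2 * S - 1) := by
            refine pow_le_pow_left₀ (by positivity) ?_ _
            linarith [hℓ z hz s]
        _ ≤ (3 * X ^ h) ^ (2 * S) := pow_le_pow_right₀ (by linarith) (by omega)
    calc ∑ s, (∑ m ∈ Finset.range S, ‖iteratedDeriv m f (c s)‖ / m.factorial * ‖z - c s‖ ^ m) *
          (1 + 2 * ‖(Lagrange.basis univ c s).eval z‖) ^ (2 * S - 1)
        ≤ ∑ _s : Fin h, S * (η * X ^ S) * (3 * X ^ h) ^ (2 * S) :=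
          Finset.sum_le_sum fun s _ => mul_le_mul (hinner s) (houter s) (by positivity)
            (by positivity)
      _ = η * xiFactor h S := by
          rw [Finset.sum_const, Finset.card_univ, Fintype.card_fin, nsmul_eq_mul, xiFactor, hX]
          ring
  -- hypotheses of the abstract lemma
  have hθ' : ∀ z ∈ sphere (0 : ℂ) R, ‖f z - (quasiInterp c S f).eval z‖ ≤ Θ + η * xiFactor h S := by
    intro z hz
    have hzR : ‖z‖ ≤ R := le_of_eq (mem_sphere_zero_iff_norm.mp hz)
    exact (norm_sub_le _ _).trans (add_le_add (hΘ z hz) (hq z hzR))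
  set m₀ : ℝ := (3 * ((h : ℝ) + 1)) ^ (S * h) with hm₀
  have hm₀pos : 0 < m₀ := by positivity
  have hmF : ∀ z ∈ sphere (0 : ℂ) R, m₀ ≤ ‖∏ s, (z - c s) ^ S‖ := by
    intro z hz
    have hzR : ‖z‖ = R := mem_sphere_zero_iff_norm.mp hz
    rw [norm_prod]
    have hlow : ∀ s, (3 * ((h : ℝ) + 1)) ^ S ≤ ‖(z - c s) ^ S‖ := by
      intro s
      rw [norm_pow]
      refine pow_le_pow_left₀ (by positivity) ?_ _
      have := norm_sub_norm_le z (c s)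
      have hcs := norm_quarterNodes_le (h := h) s
      rw [hzR] at this
      rw [hR] at this
      linarith
    calc m₀ = ∏ _s : Fin h, (3 * ((h : ℝ) + 1)) ^ S := by
          rw [Finset.prod_const, Finset.card_univ, Fintype.card_fin, ← pow_mul]
      _ ≤ ∏ s, ‖(z - c s) ^ S‖ := Finset.prod_le_prod (fun s _ => by positivity) fun s _ => hlow s
  have hwR : ‖w‖ ≤ R := hw.trans (by rw [hR]; linarith)
  have key := norm_le_of_small_derivs c S hf (quarterNodes_injective h) hS hR0 hθ' hm₀pos hmF hwR
  -- `‖F(w)‖ ≤ (5/6)^{Sh} m₀`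
  have hFw : ‖∏ s, (w - c s) ^ S‖ ≤ (5 / 6 : ℝ) ^ (S * h) * m₀ := by
    rw [norm_prod]
    have hup : ∀ s, ‖(w - c s) ^ S‖ ≤ ((5 / 6 : ℝ) * (3 * ((h : ℝ) + 1))) ^ S := by
      intro s
      rw [norm_pow]
      refine pow_le_pow_left₀ (norm_nonneg _) ?_ _
      calc ‖w - c s‖ ≤ ‖w‖ + ‖c s‖ := norm_sub_le _ _
        _ ≤ ((h : ℝ) + 1) + ((h : ℝ) + 2) := add_le_add hw (norm_quarterNodes_le s)
        _ ≤ (5 / 6 : ℝ) * (3 * ((h : ℝ) + 1)) := by linarith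
    calc ∏ s, ‖(w - c s) ^ S‖ ≤ ∏ _s : Fin h, ((5 / 6 : ℝ) * (3 * ((h : ℝ) + 1))) ^ S :=
          Finset.prod_le_prod (fun s _ => norm_nonneg _) fun s _ => hup s
      _ = (5 / 6 : ℝ) ^ (S * h) * m₀ := by
          rw [Finset.prod_const, Finset.card_univ, Fintype.card_fin, ← pow_mul, mul_pow, hm₀]
  calc ‖f w‖ ≤ ‖(quasiInterp c S f).eval w‖ + (Θ + η * xiFactor h S) / m₀ * ‖∏ s, (w - c s) ^ S‖ := key
    _ ≤ η * xiFactor h S + (Θ + η * xiFactor h S) / m₀ * ((5 / 6 : ℝ) ^ (S * h) * m₀) := by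
        have h0 : 0 ≤ (Θ + η * xiFactor h S) / m₀ := by
          have := xiFactor_nonneg h S; positivity
        exact add_le_add (hq w hwR) (mul_le_mul_of_nonneg_left hFw h0)
    _ = η * xiFactor h S + (Θ + η * xiFactor h S) * (5 / 6 : ℝ) ^ (S * h) := by
        field_simp

end Literature.NumberTheory.Transcendental.Masser1975
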